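import Mathlib
import Summits.ValiantsHypothesis.ValiantsHypothesis.Theorems.MatrixDescartes.Negative.MatrixDescartesFalseOfTropicalMonster

/-!
# Route «KPlusLogSqLaw», crux `TropicalB` (stmt-ValiantsHypothesis-19771) — the MULTI-EXCHANGE LAW (t-body exchange):
# a repackaging of `t` dominant terms into `t` other present terms is slope-deficient on some proper prefix

HONEST FRAMING.  Structure lemma toward the crux `Summit.ValiantsHypothesis.ValiantsHypothesis.Theses.KPlusLogSqLaw.TropicalB` (ledger
item `stmt-ValiantsHypothesis-19771`, registered stubs `stub_tropThin` / `stub_tropFat` of `Cruxes/TropicalB/Lines/birth.lean`; cell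
`pub-symmetroid`, seat val-sym-trop-p4 g5, 2026-08-27; `--supports … --as helper`).  A necessary condition that EVERY family of dominant
terms of EVERY dominance design satisfies (any format, any regime); it proves no part of the stubs and asserts nothing about `TropicalB`
in its window, `WeakLifting`, the cell's census / doors, `MatrixDescartes` (stmt-ValiantsHypothesis-18050) or VP ≠ VNP.

THE LAW (`prefix_deficit`).  Let `P₀, …, P_{t−1}` be unique optima of one design `(d, v, ε)` at integer slopes
`θ₀ ≤ θ₁ ≤ ⋯ ≤ θ_{t−1}`, and let `Q₀, …, Q_{t−1}` be PRESENT terms (`termSign ≠ 0`), not all equal to the corresponding `P_j`, which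
REPACKAGE the `P`'s: for every column `b` and every (row, class) pair, as many `Q_j` as `P_j` put that pair into column `b` (equal
incidence counts; so valuation sums and slope sums agree).  Then some PROPER PREFIX is slope-deficient:
`∃ j ≤ t − 2, s(P₀) + ⋯ + s(P_j) < s(Q₀) + ⋯ + s(Q_j)` (`s` = total exponent).
Proof: add the `t` dominance inequalities `w_{θ_j}(P_j) > w_{θ_j}(Q_j)`; the valuations cancel, leaving `Σ θ_j (s(P_j) − s(Q_j)) > 0`
with `Σ_j (s(P_j) − s(Q_j)) = 0`; Abel summation (`Finset.sum_range_by_parts`) writes the left side as `−Σ (θ_{j+1} − θ_j)·(prefix_j)`,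
which is `≤ 0` if every proper prefix is `≥ 0`.  Equivalently (Farkas): these are exactly the infeasibility certificates of the
realisability LP whose multipliers are `0/1` on a bijection — `t = 2` is the cell's exchange / cyclewise-monotonicity principle
(`…TropicalCycleMonotone`, `…TropicalBPathCoupling`, `RefreshExclusivity.compl_sum_lt_of_dominant`), the general `t` is new in the tree.

COROLLARY (`latin_transversal`, the LATIN LAW): if the permutations of `t` dominant terms `P_j` (slopes `θ` non-decreasing in `j`) have
pairwise disjoint cell sets, and `τ₀, …, τ_{t−1}` are permutations with pairwise disjoint cell sets covering exactly the same cells, then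
the TRANSVERSAL terms `Q_i = (τ_i, classes read off the P's)` repackage the `P`'s, so some proper prefix is slope-deficient — for every
ordering of the `Q`'s.  At `m = 3` (`latin_three`, and `latin_three_S3` with every side condition discharged from «three pairwise distinct
`3 × 3` permutations of one sign» by the finite facts `S3_disjoint_of_sign_eq` / `S3_cover`): the three EVEN permutations partition the nine
cells and so do the three ODD ones, an
even and an odd permutation sharing exactly one cell; hence for any three dominant terms carrying the three even (resp. odd) permutations,
at slopes `θ_a ≤ θ_b ≤ θ_c`, and their three odd (resp. even) transversals `O`, listed in any order `(O₀, O₁, O₂)`: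
`s(P_a) < s(O₀) ∨ s(P_c) > s(O₂)` — i.e. (taking `O₀` of least and `O₂` of largest slope) the slope range of the transversals never
covers both the first and the last of the three terms.  Between two permutations of the same parity at `m = 3` the pairwise (`t = 2`)
exchange principle is VACUOUS beyond total-slope monotonicity (`σ⁻¹σ'` is a 3-cycle: no proper invariant column set), so this is the first
constraint the tree has among same-parity terms of the `m = 3` row (`6K − 11 ≤ T(3,K) ≤ ⌊(27K−17)/2⌋`).  Checked on the kernel's
counting-tight `(3,4)` chain (p431254, exponents `(0,1,5,25)`): all 16 same-parity triples satisfy it, as they must.  [this cell; the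
Abel / Farkas argument is folklore]
-/

-- `Summit.ValiantsHypothesis.ValiantsHypothesis.…` repeats a component by the D-0017 layout
-- (single-conjunct summit), which the `dupNamespace` linter flags; the name is mandated.
set_option linter.dupNamespace false
set_option autoImplicit false

namespace Summit.ValiantsHypothesis.ValiantsHypothesis.Theorems.KPlusLogSqLaw

open Summit.ValiantsHypothesis.ValiantsHypothesis.Theorems.MatrixDescartes.Negative
open Finset

namespace MultiExchange

variable {m K : ℕ}

/-! ## 1. Incidence counts determine valuation sums and slope sums -/

/-- fibrewise rewriting: a sum over the terms of what they put into column `b` is the count-weighted sum over (row, class) pairs.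
[folklore] -/
theorem sum_eq_sum_count (t : ℕ) (P : ℕ → Equiv.Perm (Fin m) × (Fin m → Fin K)) (b : Fin m) (f : Fin m × Fin K → ℤ) :
    ∑ j ∈ range t, f ((P j).1 b, (P j).2 b) =
      ∑ al : Fin m × Fin K, (((range t).filter fun j => ((P j).1 b, (P j).2 b) = al).card : ℤ) * f al := by
  rw [← Finset.sum_fiberwise_of_maps_to' (s := range t) (t := (univ : Finset (Fin m × Fin K)))
    (g := fun j => ((P j).1 b, (P j).2 b)) (fun j _ => mem_univ _) f]
  refine sum_congr rfl fun al _ => ?_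
  rw [sum_const, nsmul_eq_mul]

/-- equal incidence counts ⇒ equal sums of any (row, column, class) statistic over the two families. [folklore] -/
theorem sum_sum_eq_of_count_eq (t : ℕ) (P Q : ℕ → Equiv.Perm (Fin m) × (Fin m → Fin K))
    (hinc : ∀ (b : Fin m) (al : Fin m × Fin K),
      ((range t).filter fun j => ((P j).1 b, (P j).2 b) = al).card =
        ((range t).filter fun j => ((Q j).1 b, (Q j).2 b) = al).card)
    (g : Fin m → Fin m × Fin K → ℤ) :
    ∑ j ∈ range t, ∑ b, g b ((P j).1 b, (P j).2 b) = ∑ j ∈ range t, ∑ b, g b ((Q j).1 b, (Q j).2 b) := by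
  rw [sum_comm, sum_comm (s := range t)]
  refine sum_congr rfl fun b _ => ?_
  rw [sum_eq_sum_count t P b (g b), sum_eq_sum_count t Q b (g b)]
  refine sum_congr rfl fun al _ => ?_
  rw [hinc b al]

/-! ## 2. The multi-exchange law -/

/-- Abel summation step: if `θ` is non-decreasing on `[0, t)`, every proper prefix sum of `Δ` is `≥ 0` and the total is `0`, then
`Σ_{j<t} θ_j Δ_j ≤ 0`. [folklore] -/
theorem sum_mul_nonpos_of_prefix_nonneg (t : ℕ) (θ Δ : ℕ → ℤ) (hθ : ∀ i, i + 1 < t → θ i ≤ θ (i + 1))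
    (hpre : ∀ j, j + 1 < t → 0 ≤ ∑ i ∈ range (j + 1), Δ i) (htot : ∑ i ∈ range t, Δ i = 0) :
    ∑ j ∈ range t, θ j * Δ j ≤ 0 := by
  have h := Finset.sum_range_by_parts θ Δ t
  simp only [smul_eq_mul] at h
  rw [h, htot, mul_zero, zero_sub, neg_nonpos]
  refine sum_nonneg fun i hi => ?_
  have hi' : i + 1 < t := by
    have := mem_range.mp hi
    omega
  exact mul_nonneg (by linarith [hθ i hi']) (hpre i hi')

/-- **MULTI-EXCHANGE LAW (prefix deficit).**  `t` unique optima `P_j` at non-decreasing slopes `θ_j`, and `t` present terms `Q_j`, not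
all equal to the corresponding `P_j`, with the same incidence counts column by column: some proper prefix of the `Q`'s has strictly larger
total exponent than the same prefix of the `P`'s. [this cell; folklore Abel/Farkas argument] -/
theorem prefix_deficit (d : Fin K → ℕ) (v ε : Fin m → Fin m → Fin K → ℤ) (t : ℕ) (θ : ℕ → ℤ)
    (P Q : ℕ → Equiv.Perm (Fin m) × (Fin m → Fin K))
    (hθ : ∀ i, i + 1 < t → θ i ≤ θ (i + 1))
    (hdom : ∀ j, j < t → IsDominant d v ε (θ j) (P j))
    (hQ : ∀ j, j < t → termSign ε (Q j) ≠ 0)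
    (hne : ∃ j, j < t ∧ Q j ≠ P j)
    (hinc : ∀ (b : Fin m) (al : Fin m × Fin K),
      ((range t).filter fun j => ((P j).1 b, (P j).2 b) = al).card =
        ((range t).filter fun j => ((Q j).1 b, (Q j).2 b) = al).card) :
    ∃ j, j + 1 < t ∧
      ∑ i ∈ range (j + 1), ∑ b, (d ((P i).2 b) : ℤ) < ∑ i ∈ range (j + 1), ∑ b, (d ((Q i).2 b) : ℤ) := by
  -- valuation sums and slope sums agree
  have hV : ∑ j ∈ range t, ∑ b, v ((P j).1 b) b ((P j).2 b) = ∑ j ∈ range t, ∑ b, v ((Q j).1 b) b ((Q j).2 b) :=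
    sum_sum_eq_of_count_eq t P Q hinc fun b al => v al.1 b al.2
  have hS : ∑ j ∈ range t, ∑ b, (d ((P j).2 b) : ℤ) = ∑ j ∈ range t, ∑ b, (d ((Q j).2 b) : ℤ) :=
    sum_sum_eq_of_count_eq t P Q hinc fun _ al => (d al.2 : ℤ)
  -- the sum of the `t` dominance inequalities
  have hle : ∀ j ∈ range t, tropWeight d v (θ j) (Q j) ≤ tropWeight d v (θ j) (P j) := by
    intro j hj
    have hjt := mem_range.mp hj
    by_cases h : Q j = P j
    · rw [h]
    · exact ((hdom j hjt).2 (Q j) h (hQ j hjt)).le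
  obtain ⟨j₀, hj₀t, hj₀⟩ := hne
  have hlt : tropWeight d v (θ j₀) (Q j₀) < tropWeight d v (θ j₀) (P j₀) := (hdom j₀ hj₀t).2 (Q j₀) hj₀ (hQ j₀ hj₀t)
  have hsum : ∑ j ∈ range t, tropWeight d v (θ j) (Q j) < ∑ j ∈ range t, tropWeight d v (θ j) (P j) :=
    sum_lt_sum hle ⟨j₀, mem_range.mpr hj₀t, hlt⟩
  have hpos : 0 < ∑ j ∈ range t, θ j * (∑ b, (d ((P j).2 b) : ℤ) - ∑ b, (d ((Q j).2 b) : ℤ)) := by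
    have e : ∑ j ∈ range t, θ j * (∑ b, (d ((P j).2 b) : ℤ) - ∑ b, (d ((Q j).2 b) : ℤ)) =
        (∑ j ∈ range t, tropWeight d v (θ j) (P j)) - (∑ j ∈ range t, tropWeight d v (θ j) (Q j)) +
        ((∑ j ∈ range t, ∑ b, v ((P j).1 b) b ((P j).2 b)) - ∑ j ∈ range t, ∑ b, v ((Q j).1 b) b ((Q j).2 b)) := by
      unfold tropWeight
      rw [← sum_sub_distrib, ← sum_sub_distrib, ← sum_add_distrib]
      exact sum_congr rfl fun j _ => by ring
    rw [e, hV, sub_self, add_zero]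
    linarith
  -- Abel summation: some proper prefix of `Δ_j = s(P_j) − s(Q_j)` is negative
  by_contra hcon
  push Not at hcon
  have hpre : ∀ j, j + 1 < t → 0 ≤ ∑ i ∈ range (j + 1), (∑ b, (d ((P i).2 b) : ℤ) - ∑ b, (d ((Q i).2 b) : ℤ)) := by
    intro j hj
    rw [sum_sub_distrib]
    linarith [hcon j hj]
  have htot : ∑ i ∈ range t, (∑ b, (d ((P i).2 b) : ℤ) - ∑ b, (d ((Q i).2 b) : ℤ)) = 0 := by
    rw [sum_sub_distrib, hS, sub_self]
  have := sum_mul_nonpos_of_prefix_nonneg t θ _ hθ hpre htot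
  linarith

/-! ## 3. The Latin (transversal) law -/

/-- Latin hypotheses ⇒ equal incidence counts: if the `P_j` have pairwise cell-disjoint permutations, the `Q_i` likewise, the two
families cover the same cells, and each `Q_i` reads its classes off the `P` containing the cell, then column by column every
(row, class) pair is used equally often (zero times or once) by the two families. [this cell] -/
theorem count_eq_of_latin (t : ℕ) (P Q : ℕ → Equiv.Perm (Fin m) × (Fin m → Fin K))
    (hdisjP : ∀ j j', j < t → j' < t → j ≠ j' → ∀ b, (P j).1 b ≠ (P j').1 b)
    (hdisjQ : ∀ i i', i < t → i' < t → i ≠ i' → ∀ b, (Q i).1 b ≠ (Q i').1 b)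
    (hcover : ∀ i, i < t → ∀ b, ∃ j, j < t ∧ (P j).1 b = (Q i).1 b)
    (hcover' : ∀ j, j < t → ∀ b, ∃ i, i < t ∧ (Q i).1 b = (P j).1 b)
    (hread : ∀ i j, i < t → j < t → ∀ b, (Q i).1 b = (P j).1 b → (Q i).2 b = (P j).2 b)
    (b : Fin m) (al : Fin m × Fin K) :
    ((range t).filter fun j => ((P j).1 b, (P j).2 b) = al).card =
      ((range t).filter fun j => ((Q j).1 b, (Q j).2 b) = al).card := by
  obtain ⟨a, l⟩ := al
  -- both counts are `≤ 1` and they are positive together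
  have hP1 : ((range t).filter fun j => ((P j).1 b, (P j).2 b) = (a, l)).card ≤ 1 := by
    rw [Finset.card_le_one]
    intro j hj j' hj'
    obtain ⟨hj, hjq⟩ := mem_filter.mp hj
    obtain ⟨hj', hjq'⟩ := mem_filter.mp hj'
    by_contra hne'
    exact hdisjP j j' (mem_range.mp hj) (mem_range.mp hj') hne' b ((Prod.mk.inj hjq).1.trans (Prod.mk.inj hjq').1.symm)
  have hQ1 : ((range t).filter fun i => ((Q i).1 b, (Q i).2 b) = (a, l)).card ≤ 1 := by
    rw [Finset.card_le_one]
    intro i hi i' hi'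
    obtain ⟨hi, hiq⟩ := mem_filter.mp hi
    obtain ⟨hi', hiq'⟩ := mem_filter.mp hi'
    by_contra hne'
    exact hdisjQ i i' (mem_range.mp hi) (mem_range.mp hi') hne' b ((Prod.mk.inj hiq).1.trans (Prod.mk.inj hiq').1.symm)
  have hPQ : (∃ j ∈ range t, ((P j).1 b, (P j).2 b) = (a, l)) ↔ (∃ i ∈ range t, ((Q i).1 b, (Q i).2 b) = (a, l)) := by
    constructor
    · rintro ⟨j, hj, hjq⟩
      obtain ⟨h1, h2⟩ := Prod.mk.inj hjq
      obtain ⟨i, hit, hi⟩ := hcover' j (mem_range.mp hj) b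
      refine ⟨i, mem_range.mpr hit, ?_⟩
      rw [hread i j hit (mem_range.mp hj) b hi, hi, h1, h2]
    · rintro ⟨i, hi, hiq⟩
      obtain ⟨h1, h2⟩ := Prod.mk.inj hiq
      obtain ⟨j, hjt, hj⟩ := hcover i (mem_range.mp hi) b
      refine ⟨j, mem_range.mpr hjt, ?_⟩
      rw [← hread i j (mem_range.mp hi) hjt b hj.symm, hj, h1, h2]
  have hiffP : 0 < ((range t).filter fun j => ((P j).1 b, (P j).2 b) = (a, l)).card ↔
      ∃ j ∈ range t, ((P j).1 b, (P j).2 b) = (a, l) := by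
    rw [Finset.card_pos]
    constructor
    · rintro ⟨j, hj⟩
      exact ⟨j, (mem_filter.mp hj).1, (mem_filter.mp hj).2⟩
    · rintro ⟨j, hj, hjq⟩
      exact ⟨j, mem_filter.mpr ⟨hj, hjq⟩⟩
  have hiffQ : 0 < ((range t).filter fun i => ((Q i).1 b, (Q i).2 b) = (a, l)).card ↔
      ∃ i ∈ range t, ((Q i).1 b, (Q i).2 b) = (a, l) := by
    rw [Finset.card_pos]
    constructor
    · rintro ⟨i, hi⟩
      exact ⟨i, (mem_filter.mp hi).1, (mem_filter.mp hi).2⟩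
    · rintro ⟨i, hi, hiq⟩
      exact ⟨i, mem_filter.mpr ⟨hi, hiq⟩⟩
  by_cases h : ∃ j ∈ range t, ((P j).1 b, (P j).2 b) = (a, l)
  · have h1 := hiffP.mpr h
    have h2 := hiffQ.mpr (hPQ.mp h)
    omega
  · have h1 : ¬ 0 < ((range t).filter fun j => ((P j).1 b, (P j).2 b) = (a, l)).card := fun hh => h (hiffP.mp hh)
    have h2 : ¬ 0 < ((range t).filter fun i => ((Q i).1 b, (Q i).2 b) = (a, l)).card :=
      fun hh => h (hPQ.mpr (hiffQ.mp hh))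
    omega

/-- **LATIN TRANSVERSAL LAW.**  `t` unique optima `P_j` at non-decreasing slopes whose permutations have pairwise disjoint cell sets, and
`t` permutations with pairwise disjoint cell sets covering exactly the same cells; the transversal terms `Q_i = (τ_i, μ_i)` read
`μ_i b =` the class of the cell `(τ_i b, b)` in the `P` that contains it (`hread`).  Then (the `Q`'s being present and not all equal to
the `P`'s) some proper prefix of the `Q`'s out-slopes the same prefix of the `P`'s — for every indexing of the `Q`'s. [this cell] -/
theorem latin_transversal (d : Fin K → ℕ) (v ε : Fin m → Fin m → Fin K → ℤ) (t : ℕ) (θ : ℕ → ℤ)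
    (P Q : ℕ → Equiv.Perm (Fin m) × (Fin m → Fin K))
    (hθ : ∀ i, i + 1 < t → θ i ≤ θ (i + 1))
    (hdom : ∀ j, j < t → IsDominant d v ε (θ j) (P j))
    (hQ : ∀ j, j < t → termSign ε (Q j) ≠ 0)
    (hne : ∃ j, j < t ∧ Q j ≠ P j)
    (hdisjP : ∀ j j', j < t → j' < t → j ≠ j' → ∀ b, (P j).1 b ≠ (P j').1 b)
    (hdisjQ : ∀ i i', i < t → i' < t → i ≠ i' → ∀ b, (Q i).1 b ≠ (Q i').1 b)
    (hcover : ∀ i, i < t → ∀ b, ∃ j, j < t ∧ (P j).1 b = (Q i).1 b)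
    (hcover' : ∀ j, j < t → ∀ b, ∃ i, i < t ∧ (Q i).1 b = (P j).1 b)
    (hread : ∀ i j, i < t → j < t → ∀ b, (Q i).1 b = (P j).1 b → (Q i).2 b = (P j).2 b) :
    ∃ j, j + 1 < t ∧
      ∑ i ∈ range (j + 1), ∑ b, (d ((P i).2 b) : ℤ) < ∑ i ∈ range (j + 1), ∑ b, (d ((Q i).2 b) : ℤ) :=
  prefix_deficit d v ε t θ P Q hθ hdom hQ hne (count_eq_of_latin t P Q hdisjP hdisjQ hcover hcover' hread)

/-- **THE LATIN LAW, three-term form (the `m = 3` case: the three even, or the three odd, permutations).**  Three unique optima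
`P₀, P₁, P₂` at slopes `θ₀ ≤ θ₁ ≤ θ₂` with pairwise cell-disjoint permutations, and their transversal terms `Q₀, Q₁, Q₂` in ANY order
(pairwise cell-disjoint permutations covering the same cells, classes read off the `P`'s, present, not all equal to the `P`'s):
`s(P₀) < s(Q₀)` or `s(Q₂) < s(P₂)`.  Listing the transversals with `Q₀` of least and `Q₂` of largest slope: the slope range of the
transversals never contains both `s(P₀)` and `s(P₂)`.  At `m = 3` an even and an odd permutation share exactly one cell and two
permutations of equal parity share none, so this applies to ANY three dominant terms carrying the three even (or the three odd)
permutations, with the three odd (even) transversals; the pairwise exchange principle says nothing there. [this cell] -/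
theorem latin_three (d : Fin K → ℕ) (v ε : Fin m → Fin m → Fin K → ℤ) (θ : ℕ → ℤ)
    (P Q : ℕ → Equiv.Perm (Fin m) × (Fin m → Fin K))
    (hθ : θ 0 ≤ θ 1 ∧ θ 1 ≤ θ 2)
    (hdom : ∀ j, j < 3 → IsDominant d v ε (θ j) (P j))
    (hQ : ∀ j, j < 3 → termSign ε (Q j) ≠ 0)
    (hne : ∃ j, j < 3 ∧ Q j ≠ P j)
    (hdisjP : ∀ j j', j < 3 → j' < 3 → j ≠ j' → ∀ b, (P j).1 b ≠ (P j').1 b)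
    (hdisjQ : ∀ i i', i < 3 → i' < 3 → i ≠ i' → ∀ b, (Q i).1 b ≠ (Q i').1 b)
    (hcover : ∀ i, i < 3 → ∀ b, ∃ j, j < 3 ∧ (P j).1 b = (Q i).1 b)
    (hcover' : ∀ j, j < 3 → ∀ b, ∃ i, i < 3 ∧ (Q i).1 b = (P j).1 b)
    (hread : ∀ i j, i < 3 → j < 3 → ∀ b, (Q i).1 b = (P j).1 b → (Q i).2 b = (P j).2 b) :
    ∑ b, (d ((P 0).2 b) : ℤ) < ∑ b, (d ((Q 0).2 b) : ℤ) ∨ ∑ b, (d ((Q 2).2 b) : ℤ) < ∑ b, (d ((P 2).2 b) : ℤ) := by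
  have hθ' : ∀ i, i + 1 < 3 → θ i ≤ θ (i + 1) := by
    intro i hi
    have hi2 : i < 2 := by omega
    interval_cases i
    · exact hθ.1
    · exact hθ.2
  have hinc := count_eq_of_latin 3 P Q hdisjP hdisjQ hcover hcover' hread
  obtain ⟨j, hj, hlt⟩ := prefix_deficit d v ε 3 θ P Q hθ' hdom hQ hne hinc
  have hS : ∑ j ∈ range 3, ∑ b, (d ((P j).2 b) : ℤ) = ∑ j ∈ range 3, ∑ b, (d ((Q j).2 b) : ℤ) :=
    sum_sum_eq_of_count_eq 3 P Q hinc fun _ al => (d al.2 : ℤ)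
  rcases Nat.lt_or_ge j 1 with hj0 | hj1
  · have : j = 0 := by omega
    subst this
    left
    simpa using hlt
  · have : j = 1 := by omega
    subst this
    right
    simp only [Finset.sum_range_succ, Finset.sum_range_zero, zero_add] at hS hlt
    linarith

/-! ## 4. The `m = 3` instance with all side conditions discharged -/

/-- finite fact about `S₃`: two distinct permutations of the same sign share no cell. -/
theorem S3_disjoint_of_sign_eq : ∀ σ σ' : Equiv.Perm (Fin 3), σ ≠ σ' → Equiv.Perm.sign σ = Equiv.Perm.sign σ' →
    ∀ b, σ b ≠ σ' b := by
  decide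

/-- fact about `S₃`: three pairwise distinct permutations of one sign cover every cell — in each column their three rows are
pairwise distinct (`S3_disjoint_of_sign_eq`), hence all of `Fin 3`. -/
theorem S3_cover (σ₀ σ₁ σ₂ : Equiv.Perm (Fin 3)) (h01 : σ₀ ≠ σ₁) (h02 : σ₀ ≠ σ₂) (h12 : σ₁ ≠ σ₂)
    (hs01 : Equiv.Perm.sign σ₀ = Equiv.Perm.sign σ₁) (hs12 : Equiv.Perm.sign σ₁ = Equiv.Perm.sign σ₂)
    (b a : Fin 3) : σ₀ b = a ∨ σ₁ b = a ∨ σ₂ b = a := by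
  have d01 := S3_disjoint_of_sign_eq σ₀ σ₁ h01 hs01 b
  have d02 := S3_disjoint_of_sign_eq σ₀ σ₂ h02 (hs01.trans hs12) b
  have d12 := S3_disjoint_of_sign_eq σ₁ σ₂ h12 hs12 b
  have hcard : ({σ₀ b, σ₁ b, σ₂ b} : Finset (Fin 3)).card = 3 := by
    rw [Finset.card_insert_of_notMem, Finset.card_insert_of_notMem, Finset.card_singleton]
    · simpa using d12
    · simp only [Finset.mem_insert, Finset.mem_singleton, not_or]
      exact ⟨d01, d02⟩
  have huniv : ({σ₀ b, σ₁ b, σ₂ b} : Finset (Fin 3)) = univ :=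
    Finset.eq_univ_of_card _ (by rw [hcard, Fintype.card_fin])
  have ha : a ∈ ({σ₀ b, σ₁ b, σ₂ b} : Finset (Fin 3)) := by rw [huniv]; exact mem_univ a
  simp only [Finset.mem_insert, Finset.mem_singleton] at ha
  rcases ha with h | h | h
  · exact Or.inl h.symm
  · exact Or.inr (Or.inl h.symm)
  · exact Or.inr (Or.inr h.symm)

/-- **THE LATIN LAW OF THE `m = 3` ROW.**  Let `P₀, P₁, P₂` be unique optima of a `3 × 3` design at slopes `θ₀ ≤ θ₁ ≤ θ₂` whose
permutations are the three permutations of one sign (in any order), and let `Q₀, Q₁, Q₂` carry the three permutations of the other sign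
(in any order) with classes read off the `P`'s (`hread`: `Q_i` gives the cell it shares with `P_j` the class `P_j` gives it).  Then
`s(P₀) < s(Q₀)` or `s(Q₂) < s(P₂)`: the transversal slopes cannot reach below the first AND above the last of the three terms.
Presence of the `Q`'s and all Latin side conditions are automatic. [this cell] -/
theorem latin_three_S3 {K : ℕ} (d : Fin K → ℕ) (v ε : Fin 3 → Fin 3 → Fin K → ℤ) (θ : ℕ → ℤ)
    (P Q : ℕ → Equiv.Perm (Fin 3) × (Fin 3 → Fin K))
    (hθ : θ 0 ≤ θ 1 ∧ θ 1 ≤ θ 2)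
    (hdom : ∀ j, j < 3 → IsDominant d v ε (θ j) (P j))
    (hPdist : (P 0).1 ≠ (P 1).1 ∧ (P 0).1 ≠ (P 2).1 ∧ (P 1).1 ≠ (P 2).1)
    (hPsign : Equiv.Perm.sign (P 0).1 = Equiv.Perm.sign (P 1).1 ∧ Equiv.Perm.sign (P 1).1 = Equiv.Perm.sign (P 2).1)
    (hQdist : (Q 0).1 ≠ (Q 1).1 ∧ (Q 0).1 ≠ (Q 2).1 ∧ (Q 1).1 ≠ (Q 2).1)
    (hQsign : Equiv.Perm.sign (Q 0).1 = Equiv.Perm.sign (Q 1).1 ∧ Equiv.Perm.sign (Q 1).1 = Equiv.Perm.sign (Q 2).1)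
    (hopp : Equiv.Perm.sign (Q 0).1 ≠ Equiv.Perm.sign (P 0).1)
    (hread : ∀ i j, i < 3 → j < 3 → ∀ b, (Q i).1 b = (P j).1 b → (Q i).2 b = (P j).2 b) :
    ∑ b, (d ((P 0).2 b) : ℤ) < ∑ b, (d ((Q 0).2 b) : ℤ) ∨ ∑ b, (d ((Q 2).2 b) : ℤ) < ∑ b, (d ((P 2).2 b) : ℤ) := by
  -- unpack «three pairwise distinct permutations of one sign» into index form
  have hPs : ∀ j, j < 3 → Equiv.Perm.sign (P j).1 = Equiv.Perm.sign (P 0).1 := by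
    intro j hj
    interval_cases j
    · rfl
    · exact hPsign.1.symm
    · exact (hPsign.1.trans hPsign.2).symm
  have hQs : ∀ i, i < 3 → Equiv.Perm.sign (Q i).1 = Equiv.Perm.sign (Q 0).1 := by
    intro i hi
    interval_cases i
    · rfl
    · exact hQsign.1.symm
    · exact (hQsign.1.trans hQsign.2).symm
  have hPd : ∀ j j', j < 3 → j' < 3 → j ≠ j' → (P j).1 ≠ (P j').1 := by
    intro j j' hj hj' hne
    interval_cases j <;> interval_cases j' <;> first
      | exact absurd rfl hne | exact hPdist.1 | exact hPdist.2.1 | exact hPdist.2.2 | exact hPdist.1.symm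
      | exact hPdist.2.1.symm | exact hPdist.2.2.symm
  have hQd : ∀ i i', i < 3 → i' < 3 → i ≠ i' → (Q i).1 ≠ (Q i').1 := by
    intro i i' hi hi' hne
    interval_cases i <;> interval_cases i' <;> first
      | exact absurd rfl hne | exact hQdist.1 | exact hQdist.2.1 | exact hQdist.2.2 | exact hQdist.1.symm
      | exact hQdist.2.1.symm | exact hQdist.2.2.symm
  have hdisjP : ∀ j j', j < 3 → j' < 3 → j ≠ j' → ∀ b, (P j).1 b ≠ (P j').1 b := fun j j' hj hj' hne =>
    S3_disjoint_of_sign_eq _ _ (hPd j j' hj hj' hne) ((hPs j hj).trans (hPs j' hj').symm)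
  have hdisjQ : ∀ i i', i < 3 → i' < 3 → i ≠ i' → ∀ b, (Q i).1 b ≠ (Q i').1 b := fun i i' hi hi' hne =>
    S3_disjoint_of_sign_eq _ _ (hQd i i' hi hi' hne) ((hQs i hi).trans (hQs i' hi').symm)
  have hcover : ∀ i, i < 3 → ∀ b, ∃ j, j < 3 ∧ (P j).1 b = (Q i).1 b := by
    intro i _ b
    rcases S3_cover (P 0).1 (P 1).1 (P 2).1 hPdist.1 hPdist.2.1 hPdist.2.2 hPsign.1 hPsign.2 b ((Q i).1 b) with h | h | h
    · exact ⟨0, by omega, h⟩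
    · exact ⟨1, by omega, h⟩
    · exact ⟨2, by omega, h⟩
  have hcover' : ∀ j, j < 3 → ∀ b, ∃ i, i < 3 ∧ (Q i).1 b = (P j).1 b := by
    intro j _ b
    rcases S3_cover (Q 0).1 (Q 1).1 (Q 2).1 hQdist.1 hQdist.2.1 hQdist.2.2 hQsign.1 hQsign.2 b ((P j).1 b) with h | h | h
    · exact ⟨0, by omega, h⟩
    · exact ⟨1, by omega, h⟩
    · exact ⟨2, by omega, h⟩
  -- presence of the transversals: their incidences are incidences of the (present) `P`'s
  have hQ : ∀ i, i < 3 → termSign ε (Q i) ≠ 0 := by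
    intro i hi
    have e : Q i = ((Q i).1, (Q i).2) := rfl
    rw [e]
    unfold termSign
    refine mul_ne_zero (Units.ne_zero _) (Finset.prod_ne_zero_iff.mpr fun b _ => ?_)
    obtain ⟨j, hj, hjb⟩ := hcover i hi b
    rw [← hjb, hread i j hi hj b hjb.symm]
    intro h0
    apply (hdom j hj).1
    have e' : P j = ((P j).1, (P j).2) := rfl
    rw [e']
    unfold termSign
    exact mul_eq_zero_of_right _ (Finset.prod_eq_zero (Finset.mem_univ b) h0)
  have hne : ∃ j, j < 3 ∧ Q j ≠ P j := ⟨0, by omega, fun h => hopp (by rw [h])⟩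
  exact latin_three d v ε θ P Q hθ hdom hQ hne hdisjP hdisjQ hcover hcover' hread

end MultiExchange

end Summit.ValiantsHypothesis.ValiantsHypothesis.Theorems.KPlusLogSqLaw
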